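import Mathlib
import Summits.PneNP.PneNP.Theses.LatticeMagic
import Literature.Computability.MetaComplexity.XorPseudoexpectation
import Literature.Computability.MetaComplexity.SOSThreeColouringProofs

/-!
# Skeleton — crux stmt-PneNP-2330 `BooleanSosBlindAtConstantFactor`, line `Sketch` (Construction-A road)

Lead prover's registered skeleton (prover-line-stmt-PneNP-2330-0). Sorries ONLY in `stub_*`; the
composition `BooleanSosBlindAtConstantFactor_of` is sorry-free and concludes the crux BY NAME from the
four stub statements. §1–§3 = the line's vocabulary, a VERBATIM copy of the LANDED Defs file
`Summits/PneNP/PneNP/Theorems/LatticeMagicBooleanSosBlindAtConstantFactorDefs.lean` (p101495, accepted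
2026-08-16T12:13Z; inlined here only because the off-box farm has not rebuilt that module yet — the stub
files import the Defs module, same fully-qualified names).

Road: Construction-A pullback of the tree's PROVED Grigoriev–Schoenebeck parity functional
(`XorDerivation` / `XorPseudoexpectation`) along the local substitution
`x_(i,1) ↦ phiX i, x_(i,2) ↦ 1 (i < N); x_(N+e,1) ↦ h_e, x_(N+e,2) ↦ 1 − h_e,
h_e = (Σ_{v ∈ scope (C e)} phiX v − rhsBit (C e))/2; everything else ↦ 0`, for the instance
`conAInstance N me C d₀` of an unsatisfiable cover-expanding 3-CNF (`exists_unsat_coverExpander`),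
`N = K²`, `d₀ = K`, `m = 2`, `γ₀ = 1`, `δ = 1/2`, `C = 3`.
-/

set_option linter.dupNamespace false -- `Summit.PneNP.PneNP.…`: summit = sub-problem (D-0017)

namespace Summit.PneNP.PneNP.Theorems.ConA

open scoped BigOperators
open Literature.Algebra.EuclideanLattices Literature.Computability.Complexity
  Literature.Computability.MetaComplexity

noncomputable section

/-! ## §1 The crux, read back -/

/-- The CLOSENESS POLYNOMIAL of the crux for an instance `p = ((B, t), d)` and bit budget `m`:
`‖z B − t‖² + Σ_{b<m} 2^b x_(b,0) − ⌊d²⌋` with `z_i = Σ_{b<m} 2^b x_(i,b+1) − 2^{m−1}` (two's complement),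
variables indexed by `Nat.pair` — copied verbatim from the route decl
`Summit.PneNP.PneNP.Theses.LatticeMagic.BooleanSosBlindAtConstantFactor`. (line vocabulary) -/
def closenessPoly (p : GapCVPInstance) (m : ℕ) : MvPolynomial ℕ ℝ :=
  (∑ k : Fin p.1.I.n, (∑ i : Fin p.1.I.n, ((∑ b ∈ Finset.range m, ((2 : ℝ) ^ b) •
    MvPolynomial.X (Nat.pair i.val (b + 1))) - MvPolynomial.C ((2 ^ (m - 1) : ℕ) : ℝ)) *
    MvPolynomial.C ((p.1.I.basis i k : ℤ) : ℝ) - MvPolynomial.C ((p.1.target k : ℤ) : ℝ)) ^ 2) +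
    (∑ b ∈ Finset.range m, ((2 : ℝ) ^ b) • MvPolynomial.X (Nat.pair b 0)) -
    MvPolynomial.C ((⌊(p.2 : ℝ) ^ 2⌋ : ℤ) : ℝ)

/-- "Degree-`D` Boolean SOS does NOT refute the closeness system of `(p, m)`": some degree-`D`
pseudoexpectation satisfies every Booleanity identity and the closeness identity (KMOW primal form,
tree vocabulary of `Literature/Computability/MetaComplexity/SumOfSquares.lean`). (line vocabulary) -/
def Fooled (D : ℕ) (p : GapCVPInstance) (m : ℕ) : Prop :=
  ∃ E : MvPolynomial ℕ ℝ →ₗ[ℝ] ℝ, IsPseudoexpectation D E ∧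
    (∀ v : ℕ, SatisfiesIdentity D E (boolAxiom v)) ∧ SatisfiesIdentity D E (closenessPoly p m)

/-- Readback: the crux is LITERALLY `∃ γ₀ ≥ 1, ∃ δ > 0, ∃ C, ∀ n₀, ∃ p m, n₀ ≤ n ∧ p ∈ GapCVP.no γ₀ ∧
|code p| ≤ n^C ∧ m ≤ n^C ∧ Fooled ⌈n^δ⌉₊ p m` (definitional unfolding only). (line vocabulary) -/
theorem crux_iff : Summit.PneNP.PneNP.Theses.LatticeMagic.BooleanSosBlindAtConstantFactor ↔
    ∃ γ₀ : ℝ, 1 ≤ γ₀ ∧ ∃ δ : ℝ, 0 < δ ∧ ∃ C : ℕ, ∀ n₀ : ℕ, ∃ (p : GapCVPInstance) (m : ℕ),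
      n₀ ≤ p.1.I.n ∧ p ∈ GapCVP.no (fun _ => γ₀) ∧ (GapCVPInstance.encode p).length ≤ p.1.I.n ^ C ∧
      m ≤ p.1.I.n ^ C ∧ Fooled ⌈(p.1.I.n : ℝ) ^ δ⌉₊ p m :=
  Iff.rfl

/-! ## §2 The Construction-A instance of a clause family -/

/-- The integer sign of a literal: `+1` for a positive literal `(v, true)`, `−1` for a negative one
(the integer shadow of the tree's real `litSign`). (line vocabulary) -/
def litSignZ (l : Literal ℕ) : ℤ :=
  if l.2 then 1 else -1

/-- The XOR right-hand side of a clause: the parity constraint "an odd number of literals of `C` is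
true" reads `Σ_{v ∈ scope C} x_v ≡ rhsBit C (mod 2)` with `rhsBit C = 1` iff the number of negative
literals is even, i.e. iff `∏_l litSignZ l = 1` (equivalently `clauseSign C = −1`). (line vocabulary) -/
def rhsBit (C : Clause ℕ) : ℤ :=
  if (C.map litSignZ).prod = 1 then 1 else 0

/-- The scope-incidence block: `incBlock N me C i e = 1` if the variable `i < N` occurs in the clause
`C e`, else `0` (an `N × me` integer matrix; column `e` is the indicator of `scope (C e)`).
(line vocabulary) -/
def incBlock (N me : ℕ) (C : Fin me → Clause ℕ) : Matrix (Fin N) (Fin me) ℤ :=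
  Matrix.of fun i e => if (i : ℕ) ∈ clauseScope (C e) then 1 else 0

/-- The Construction-A basis of the clause family, dimension `N + me`: in block form (message block
`Fin N`, check block `Fin me`, glued by `finSumFinEquiv`) it is `[[2·I_N, incBlock], [0, 2·I_me]]`,
i.e. rows `b_i = 2 e_i + Σ_{e : i ∈ scope (C e)} e_{N+e}` for `i < N` and `b_{N+e} = 2 e_{N+e}`; block
upper triangular with determinant `2^(N+me)`. (line vocabulary) -/
def conABasis (N me : ℕ) (C : Fin me → Clause ℕ) : Matrix (Fin (N + me)) (Fin (N + me)) ℤ :=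
  Matrix.reindex finSumFinEquiv finSumFinEquiv
    (Matrix.fromBlocks (Matrix.diagonal fun _ => 2) (incBlock N me C) 0 (Matrix.diagonal fun _ => 2))

/-- The Construction-A target `t = (1, …, 1 | rhsBit (C e))`: the deep hole `(1, …, 1)` of `2ℤ^N` in the
message block, the XOR right-hand sides in the check block. (line vocabulary) -/
def conATarget (N me : ℕ) (C : Fin me → Clause ℕ) : Fin (N + me) → ℤ :=
  fun k => Sum.elim (fun _ => (1 : ℤ)) (fun e => rhsBit (C e)) (finSumFinEquiv.symm k)

/-- The Construction-A `GapCVP` instance `((B, t), d₀)` of the clause family with threshold `d₀`.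
(line vocabulary) -/
def conAInstance (N me : ℕ) (C : Fin me → Clause ℕ) (d₀ : ℚ) : GapCVPInstance :=
  (⟨⟨N + me, conABasis N me C⟩, conATarget N me C⟩, d₀)

/-- INTEGER-PARITY UNSATISFIABILITY of the scope system: for every integer vector `u ∈ ℤ^N` some check
`e` has `Σ_i u_i · [i ∈ scope (C e)] ≢ rhsBit (C e) (mod 2)` (the sum is written exactly as the
check-block coordinate of `u ᵥ* incBlock`). This is what makes every lattice vector pay `≥ 1` on some
check coordinate. (line vocabulary) -/
def XorUnsat (N me : ℕ) (C : Fin me → Clause ℕ) : Prop :=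
  ∀ u : Fin N → ℤ, ∃ e : Fin me,
    ¬ (2 : ℤ) ∣ (∑ i : Fin N, u i * (if (i : ℕ) ∈ clauseScope (C e) then 1 else 0)) - rhsBit (C e)

/-! ## §3 Elementary sanity facts -/

/-- The dimension of the Construction-A instance is `N + me` (definitionally). (line vocabulary) -/
@[simp] theorem conAInstance_n (N me : ℕ) (C : Fin me → Clause ℕ) (d₀ : ℚ) :
    (conAInstance N me C d₀).1.I.n = N + me := rfl

/-- The threshold of the Construction-A instance is `d₀` (definitionally). (line vocabulary) -/
@[simp] theorem conAInstance_snd (N me : ℕ) (C : Fin me → Clause ℕ) (d₀ : ℚ) :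
    (conAInstance N me C d₀).2 = d₀ := rfl

/-- `rhsBit C ∈ {0, 1}`. (line vocabulary) -/
theorem rhsBit_eq_zero_or_one (C : Clause ℕ) : rhsBit C = 0 ∨ rhsBit C = 1 := by
  unfold rhsBit; split_ifs <;> simp


/-! ## §4 The stubs -/

/-- STUB (lead): the pushforward of the Grigoriev–Schoenebeck functional fools the closeness system of
the Construction-A instance in degree `D` whenever `3 D + 3 ≤ Dx ≤ c r / 2` and `⌊d₀²⌋ = N`. -/
theorem stub_fooled {N me : ℕ} (C : Fin me → Clause ℕ) (hC : ∀ e, C e ∈ kClauses 3 N)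
    {r c : ℝ} {Dx D : ℕ} (hexp : VecExpands (fun e => clauseVec (C e)) r c) (hc : 0 < c) (hr : 2 ≤ r)
    (hDx : (Dx : ℝ) ≤ c * r / 2) (hD : 3 * D + 3 ≤ Dx) (d₀ : ℚ) (hd₀ : ⌊(d₀ : ℝ) ^ 2⌋ = N) :
    Fooled D (conAInstance N me C d₀) 2 := by
  sorry

/-- STUB: integer-parity unsatisfiability makes the Construction-A instance a NO-instance of `GapCVP_1`
for every threshold `0 < d₀` with `d₀² < N + 1` (`det = 2^(N+me) ≠ 0`; every lattice vector `z ᵥ* B`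
has `‖z ᵥ* B − t‖² = Σ_i (2 u_i − 1)² + Σ_e (Σ_{scope} u + 2 w_e − rhsBit)² ≥ N + 1`). -/
theorem stub_no {N me : ℕ} (C : Fin me → Clause ℕ) (hX : XorUnsat N me C) (d₀ : ℚ) (hd0 : 0 < d₀)
    (hdN : (d₀ : ℝ) ^ 2 < N + 1) : conAInstance N me C d₀ ∈ GapCVP.no (fun _ => (1 : ℝ)) := by
  sorry

/-- STUB: an unsatisfiable 3-CNF from `kClauses 3 N` gives an integer-parity-unsatisfiable scope system
(a parity solution `u mod 2` would make an odd number of literals true in every clause). -/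
theorem stub_parity {N me : ℕ} (C : Fin me → Clause ℕ) (hC : ∀ e, C e ∈ kClauses 3 N)
    (hunsat : ¬ CNF.Satisfiable (List.ofFn C)) : XorUnsat N me C := by
  sorry

/-- STUB: the code of the Construction-A instance with integer threshold `K` has length
`O((N + me + 1)² + log K)` (entries in `{0, 1, 2}`, target entries in `{0, 1}`). -/
theorem stub_encode : ∃ c : ℕ, ∀ (N me : ℕ) (C : Fin me → Clause ℕ) (K : ℕ),
    (GapCVPInstance.encode (conAInstance N me C (K : ℚ))).length ≤
      c * ((N + me + 1) ^ 2 + Nat.log 2 K + 1) := by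
  sorry

/-! ## §5 Registered aliases and the composition -/

namespace __Registered

/-- Alias keyed by the registered stub name `stub_fooled` (lead). -/
abbrev stub_fooled : Prop :=
  ∀ {N me : ℕ} (C : Fin me → Clause ℕ), (∀ e, C e ∈ kClauses 3 N) →
    ∀ {r c : ℝ} {Dx D : ℕ}, VecExpands (fun e => clauseVec (C e)) r c → 0 < c → 2 ≤ r →
    (Dx : ℝ) ≤ c * r / 2 → 3 * D + 3 ≤ Dx → ∀ d₀ : ℚ, ⌊(d₀ : ℝ) ^ 2⌋ = N →
    Fooled D (conAInstance N me C d₀) 2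

/-- Alias keyed by the registered stub name `stub_no`. -/
abbrev stub_no : Prop :=
  ∀ {N me : ℕ} (C : Fin me → Clause ℕ), XorUnsat N me C → ∀ d₀ : ℚ, 0 < d₀ →
    (d₀ : ℝ) ^ 2 < N + 1 → conAInstance N me C d₀ ∈ GapCVP.no (fun _ => (1 : ℝ))

/-- Alias keyed by the registered stub name `stub_parity`. -/
abbrev stub_parity : Prop :=
  ∀ {N me : ℕ} (C : Fin me → Clause ℕ), (∀ e, C e ∈ kClauses 3 N) →
    ¬ CNF.Satisfiable (List.ofFn C) → XorUnsat N me C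

/-- Alias keyed by the registered stub name `stub_encode`. -/
abbrev stub_encode : Prop :=
  ∃ c : ℕ, ∀ (N me : ℕ) (C : Fin me → Clause ℕ) (K : ℕ),
    (GapCVPInstance.encode (conAInstance N me C (K : ℚ))).length ≤
      c * ((N + me + 1) ^ 2 + Nat.log 2 K + 1)

end __Registered

/-- **COMPOSITION — the line concludes the crux** (sorry-free): hypotheses = the four registered stubs,
by name; conclusion = the crux BY NAME, with `γ₀ = 1`, `δ = 1/2`, `C = 3`, `m = 2`, instances
`conAInstance (K²) (6K²) C K` built on the unsatisfiable cover-expanding 3-CNFs of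
`exists_unsat_coverExpander`. -/
theorem BooleanSosBlindAtConstantFactor_of :
    __Registered.stub_fooled → __Registered.stub_no → __Registered.stub_parity →
    __Registered.stub_encode →
    Summit.PneNP.PneNP.Theses.LatticeMagic.BooleanSosBlindAtConstantFactor := by
  intro h_fooled h_no h_parity h_encode
  classical
  rw [crux_iff]
  obtain ⟨κ, hκ, -, N₀, hgood⟩ := ThreeColGadget.exists_unsat_coverExpander
  obtain ⟨cE, hcE⟩ := h_encode
  refine ⟨1, le_rfl, 1 / 2, by norm_num, 3, fun n₀ => ?_⟩
  -- the size parameter `K` (dimension `n = 7 K²`)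
  obtain ⟨K, hK⟩ : ∃ K : ℕ, N₀ + n₀ + ⌈(62 : ℝ) / κ⌉₊ + cE + 10 ≤ K := ⟨_, le_rfl⟩
  have hK10 : 10 ≤ K := by omega
  have hKN₀ : N₀ ≤ K := by omega
  have hKn₀ : n₀ ≤ K := by omega
  have hKcE : cE ≤ K := by omega
  have hK62 : ⌈(62 : ℝ) / κ⌉₊ ≤ K := by omega
  have hKpos : 0 < K := by omega
  have hKr : (10 : ℝ) ≤ K := by exact_mod_cast hK10
  have hκK : (62 : ℝ) ≤ κ * K := by
    have h1 : (62 : ℝ) / κ ≤ K := (Nat.le_ceil _).trans (by exact_mod_cast hK62)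
    rwa [div_le_iff₀ hκ, mul_comm] at h1
  obtain ⟨N, hN⟩ : ∃ N : ℕ, N = K ^ 2 := ⟨_, rfl⟩
  have hNK : K ≤ N := by rw [hN]; nlinarith
  have hN₀ : N₀ ≤ N := hKN₀.trans hNK
  have hNr : (N : ℝ) = (K : ℝ) ^ 2 := by rw [hN]; push_cast; ring
  -- the unsatisfiable expanding 3-CNF on `N` variables with `6 N` clauses
  obtain ⟨f, hunsat, hcov⟩ := hgood N hN₀
  obtain ⟨C, hCf⟩ : ∃ C : Fin (6 * N) → Clause ℕ, C = fun e => (f e : Clause ℕ) := ⟨_, rfl⟩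
  have hC : ∀ e, C e ∈ kClauses 3 N := fun e => by rw [hCf]; exact (f e).2
  have hunsat' : ¬ CNF.Satisfiable (List.ofFn C) := by rw [hCf]; exact hunsat
  have hcov' : IsCoverExpander (fun e => clauseScope (C e)) ⌊κ * N⌋₊ (7 / 4) := by
    rw [hCf]; exact hcov
  -- vector expansion of the scope vectors
  have hsc : ∀ e, (clauseScope (C e)).card ≤ 3 := fun e =>
    (card_clauseScope_le _).trans (length_of_mem_kClauses (hC e)).le
  have hbd : IsBoundaryExpander (fun e => clauseScope (C e)) ⌊κ * N⌋₊ (1 / 2) := by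
    refine IsCoverExpander.isBoundaryExpander (k := 3) hsc ?_
    norm_num
    exact hcov'
  have hvec : VecExpands (fun e => clauseVec (C e)) ⌊κ * N⌋₊ (1 / 2) := by
    have h : (fun e => clauseVec (C e)) = fun e => indVec (clauseScope (C e)) :=
      funext fun e => clauseVec_eq_indVec (nodup_map_fst_of_mem_kClauses (hC e))
    rw [h]
    exact vecExpands_of_isBoundaryExpander hbd
  -- degrees
  have hn7 : N + 6 * N = 7 * K ^ 2 := by rw [hN]; ring
  obtain ⟨D, hD⟩ : ∃ D : ℕ, D = ⌈((N + 6 * N : ℕ) : ℝ) ^ (1 / 2 : ℝ)⌉₊ := ⟨_, rfl⟩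
  have hD3K : D ≤ 3 * K := by
    rw [hD, Nat.ceil_le, hn7, ← Real.sqrt_eq_rpow]
    push_cast
    rw [Real.sqrt_le_left (by positivity)]
    nlinarith
  have hfloor : κ * N - 1 < (⌊κ * N⌋₊ : ℕ) := Nat.sub_one_lt_floor _
  have hκN : (62 : ℝ) * K ≤ κ * N := by rw [hNr]; nlinarith
  have hr2 : (2 : ℝ) ≤ (⌊κ * N⌋₊ : ℕ) := by nlinarith
  have hDx : (((3 * D + 3 : ℕ)) : ℝ) ≤ 1 / 2 * (⌊κ * N⌋₊ : ℕ) / 2 := by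
    have h1 : (D : ℝ) ≤ 3 * K := by exact_mod_cast hD3K
    push_cast
    nlinarith
  -- the four stubs
  have hX : XorUnsat N (6 * N) C := h_parity C hC hunsat'
  have hd0 : (0 : ℚ) < (K : ℚ) := by exact_mod_cast hKpos
  have hKQ : (((K : ℚ)) : ℝ) = (K : ℝ) := by push_cast; ring
  have hdN : (((K : ℚ)) : ℝ) ^ 2 < N + 1 := by rw [hKQ, ← hNr]; linarith
  have hfl : ⌊(((K : ℚ)) : ℝ) ^ 2⌋ = (N : ℤ) := by
    have : (((K : ℚ)) : ℝ) ^ 2 = ((N : ℤ) : ℝ) := by rw [hKQ, Int.cast_natCast, hNr]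
    rw [this, Int.floor_intCast]
  have hno : conAInstance N (6 * N) C (K : ℚ) ∈ GapCVP.no (fun _ => (1 : ℝ)) := h_no C hX _ hd0 hdN
  obtain ⟨E, hE, hB, hQ⟩ :=
    h_fooled C hC hvec (by norm_num) hr2 hDx (le_refl (3 * D + 3)) (K : ℚ) hfl
  -- sizes
  have hpow : 66 * K ^ 5 ≤ (7 * K ^ 2) ^ 3 := by
    have h5 : (7 * K ^ 2) ^ 3 = 343 * K ^ 6 := by ring
    have h6 : K ^ 6 = K ^ 5 * K := by ring
    rw [h5, h6]
    nlinarith [Nat.zero_le (K ^ 5)]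
  have hlen : (GapCVPInstance.encode (conAInstance N (6 * N) C (K : ℚ))).length ≤ (N + 6 * N) ^ 3 := by
    refine (hcE N (6 * N) C K).trans ?_
    rw [hn7]
    refine le_trans ?_ hpow
    have hlog : Nat.log 2 K ≤ K := Nat.log_le_self 2 K
    have hK2 : 1 ≤ K ^ 2 := Nat.one_le_pow _ _ hKpos
    have h1 : (7 * K ^ 2 + 1) ^ 2 ≤ 64 * K ^ 4 := by
      have : 7 * K ^ 2 + 1 ≤ 8 * K ^ 2 := by omega
      calc (7 * K ^ 2 + 1) ^ 2 ≤ (8 * K ^ 2) ^ 2 := Nat.pow_le_pow_left this 2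
        _ = 64 * K ^ 4 := by ring
    have hK4 : K ≤ K ^ 4 := by
      calc K = K ^ 1 := (pow_one K).symm
        _ ≤ K ^ 4 := Nat.pow_le_pow_right hKpos (by norm_num)
    have h14 : 1 ≤ K ^ 4 := Nat.one_le_pow _ _ hKpos
    have h3 : (7 * K ^ 2 + 1) ^ 2 + Nat.log 2 K + 1 ≤ 66 * K ^ 4 := by omega
    calc cE * ((7 * K ^ 2 + 1) ^ 2 + Nat.log 2 K + 1) ≤ K * (66 * K ^ 4) := Nat.mul_le_mul hKcE h3
      _ = 66 * K ^ 5 := by ring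
      _ ≤ 66 * K ^ 5 := le_rfl
  have hm : 2 ≤ (N + 6 * N) ^ 3 := by
    rw [hn7]
    refine le_trans ?_ hpow
    have : 1 ≤ K ^ 5 := Nat.one_le_pow _ _ hKpos
    omega
  have hn₀ : n₀ ≤ N + 6 * N := by omega
  refine ⟨conAInstance N (6 * N) C (K : ℚ), 2, hn₀, hno, hlen, hm, ?_⟩
  show Fooled ⌈((N + 6 * N : ℕ) : ℝ) ^ (1 / 2 : ℝ)⌉₊ (conAInstance N (6 * N) C (K : ℚ)) 2
  rw [← hD]
  exact ⟨E, hE, hB, hQ⟩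

/-- The composition fed with the stubs themselves (the closing Theorems file states this as the theorem
`booleanSosBlindAtConstantFactor_proof` once the four stubs are landed sorry-free). -/
example : Summit.PneNP.PneNP.Theses.LatticeMagic.BooleanSosBlindAtConstantFactor :=
  BooleanSosBlindAtConstantFactor_of stub_fooled stub_no stub_parity stub_encode

end

end Summit.PneNP.PneNP.Theorems.ConA
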